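import Mathlib
import Summits.Ventures.HodgeRepro.Tier4.Target
import Summits.Ventures.HodgeRepro.Tier4.LitCompactness
import Summits.Ventures.HodgeRepro.Tier4.Line3.Defs
import Summits.Ventures.HodgeRepro.Tier4.Line3.DefsLemmas
import Summits.Ventures.HodgeRepro.Tier4.Line3.IntegrableMajorant
import Summits.Ventures.HodgeRepro.Tier4.Line3.KernelIntegrable
import Summits.Ventures.HodgeRepro.Tier4.Line3.OffMainMassAssembly
import Summits.Ventures.HodgeRepro.Tier4.Line3.UnitCopyScaling
import Summits.Ventures.HodgeRepro.Tier4.Line3.UnitCopySphere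
import Summits.Ventures.HodgeRepro.Tier4.Line3.ScalarFamily
import Summits.Ventures.HodgeRepro.Tier4.Line3.ScalarCopyClassSum
import Summits.Ventures.HodgeRepro.Tier4.Line3.ScalarCopyClassSumSphere
import Summits.Ventures.HodgeRepro.Tier4.Line3.CopyRemainder

/-!
# Tier4/Line3/CopyRemainderArch — (R-a): the remainder over the copies of the centre from the ARCHIMEDEAN count on the data
(t4-x2 g2; the cut of t4-plan-3 g3 S13661 (ii), statement verbatim)

Blind re-derivation cell `pub-hodge-repro`, Tier 4 «PROVE THE STEP» (README §9–§10), LINE L3, seat t4-x2 (reserve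
wall-breaker, g2).  `RemainderCopies D S xm loc θ₁` (CopyRemainder, t4-plan-3 g3 / t4-L3-p2 g2) asks that the copies of
the centre other than the main orbit have, eventually in the depth, total norm `≤ θ₁ · Re(term main)`.  By the family-sum
identity `term_smul_family_of_sphere` (ScalarCopyClassSumSphere, t4-x2) every copy's term is
`I_∞^ε · Λ · gaussRatio ε xm · classSum_N(xm)` with the SAME class sum as the main term `I_∞ · classSum_N(xm)`, which is a
non-negative REAL under `pos` on the main classes (`classSum_eq_nonneg_real`, no summability needed: a non-summable
family has `tsum = 0`).  So the `N`-dependence factors out and the bound reduces to the `N`-FREE archimedean count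
`ArchCopyBound` on the data: `‖Σ_{C ∖ main} term_N‖ ≤ Σ_{C ∖ main} weight · S_N ≤ θ₁ · Re I_∞ · S_N = θ₁ · Re term_N(main)`.
`h02 h13` and the expansion `E` of the quoted statement are not used (kept as `_`-binders so the TYPE is the quoted one).
Nothing here asserts anything about the truth of (P); `ArchCopyBound` and `pos` are the displayed inputs.  HC_CM is NOT
proved by anyone in this repository.
-/

set_option autoImplicit false

noncomputable section

namespace Summit.Ventures.HodgeRepro.Tier4.Line3

open Summit.Ventures.HodgeRepro.Tier4
open Matrix MeasureTheory NumberField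
open Filter Topology
open scoped ComplexConjugate

open scoped Classical

namespace T4Data

variable (X : T4Data)

/-- Under `pos` at one level, the class sum of the centre is a non-negative real (a non-summable family sums to `0`). -/
theorem classSum_eq_nonneg_real (D : X.ThetaData) (K : X.Level) (γ : X.Tr K) (xm : X.Tuple)
    (hpos : ∀ c : X.MainClass K xm,
      (X.coefQ D.cf γ (X.mainRep K xm c)).im = 0 ∧ 0 ≤ (X.coefQ D.cf γ (X.mainRep K xm c)).re) :
    ∃ r : ℝ, 0 ≤ r ∧ X.classSum D.cf γ xm = r := by
  set f : X.MainClass K xm → ℂ := fun c =>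
    ((X.centerCard K : ℂ) / (X.stabCard K (X.mainRep K xm c) : ℂ)) * X.coefQ D.cf γ (X.mainRep K xm c) with hf
  have hwre : ∀ c, 0 ≤ ((X.centerCard K : ℂ) / (X.stabCard K (X.mainRep K xm c) : ℂ)).re := by
    intro c
    rw [← Complex.ofReal_natCast, ← Complex.ofReal_natCast, ← Complex.ofReal_div, Complex.ofReal_re]
    positivity
  have hwim : ∀ c, ((X.centerCard K : ℂ) / (X.stabCard K (X.mainRep K xm c) : ℂ)).im = 0 := by
    intro c
    rw [← Complex.ofReal_natCast, ← Complex.ofReal_natCast, ← Complex.ofReal_div, Complex.ofReal_im]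
  have hre : ∀ c, 0 ≤ (f c).re := by
    intro c
    obtain ⟨him, hqre⟩ := hpos c
    simp only [hf, Complex.mul_re, him, hwim c, mul_zero, sub_zero]
    exact mul_nonneg (hwre c) hqre
  have him : ∀ c, (f c).im = 0 := by
    intro c
    obtain ⟨him, -⟩ := hpos c
    simp only [hf, Complex.mul_im, him, hwim c, mul_zero, zero_mul, add_zero]
  have hS : X.classSum D.cf γ xm = ∑' c, f c := rfl
  by_cases hs : Summable f
  · refine ⟨∑' c, (f c).re, tsum_nonneg hre, ?_⟩
    rw [hS]
    apply Complex.ext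
    · rw [Complex.re_tsum hs, Complex.ofReal_re]
    · rw [Complex.im_tsum hs, Complex.ofReal_im]
      simp only [him, tsum_zero]
  · refine ⟨0, le_rfl, ?_⟩
    rw [hS, tsum_eq_zero_of_not_summable hs]
    simp

/-- **(R-a) FROM THE ARCHIMEDEAN COUNT** (t4-plan-3 g3 S13661 (ii), statement verbatim): under `pos` on the main classes,
a `CopyData` and its `ArchCopyBound θ₁`, the copies of the centre minus the main orbit are eventually of norm
`≤ θ₁ · Re(term main)`. -/
theorem remainderCopies_of_archCopyBound (D : X.ThetaData)
    (hlit : Lit.BorelHarishChandra1962_Thm11_8_fundamentalDomain_hdef X.E X.H X.τ₀ X.C)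
    {xm : X.Tuple} (_h02 : xm 2 = xm 0) (_h13 : xm 3 = xm 1)
    (hab : X.ballCoord (xm 0) 0 * X.ballCoord (xm 1) 1 - X.ballCoord (xm 0) 1 * X.ballCoord (xm 1) 0 ≠ 0)
    {level : ℕ → X.Level} (loc : ∀ N : ℕ, X.Tr (level N))
    (_E : OrbitExpansion X.Orbit X.pairing (X.term D.Φ D.cf))
    (hpos : ∃ N₀ : ℕ, ∀ N, N₀ ≤ N → ∀ c : X.MainClass (level N) xm,
      (X.coefQ D.cf (loc N) (X.mainRep (level N) xm c)).im = 0 ∧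
        0 ≤ (X.coefQ D.cf (loc N) (X.mainRep (level N) xm c)).re)
    {S : Set (Fin 4 → X.E)} (_hS : (fun _ => (1 : X.E)) ∈ S) (c : X.CopyData D S xm) {θ₁ : ℝ}
    (h : X.ArchCopyBound D S xm c θ₁) :
    X.RemainderCopies D S xm loc θ₁ := by
  obtain ⟨N₀, hpos⟩ := hpos
  obtain ⟨hws, hwsum⟩ := h
  unfold RemainderCopies
  filter_upwards [eventually_ge_atTop N₀] with N hN
  have hD := X.domain_isFundamental_of_lit' (level N) hlit
  have h2 := X.integrable_majorant D (level N) (loc N)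
  obtain ⟨r, hr0, hr⟩ := X.classSum_eq_nonneg_real D (level N) (loc N) xm (hpos N hN)
  set I : ℂ := ∫ z in ball, X.kernel D.Φ xm z with hI
  -- the main term
  have hmain : (X.term D.Φ D.cf (level N) (loc N) (X.orbitOf (X.lines xm))).re = I.re * r := by
    rw [X.term_main_unfold_of_wedge D xm hab (level N) (loc N) hD h2, hr, ← hI]
    simp
  -- each copy's norm is its weight times `r`
  set w : X.Orbit → ℝ := fun o => if o ∈ X.Copies S xm ∧ o ≠ X.orbitOf (X.lines xm) then c.weight o else 0 with hw
  have hnorm : ∀ o : X.Orbit,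
      ‖(if o ∈ X.Copies S xm ∧ o ≠ X.orbitOf (X.lines xm) then X.term D.Φ D.cf (level N) (loc N) o else 0)‖ =
        w o * r := by
    intro o
    by_cases ho : o ∈ X.Copies S xm ∧ o ≠ X.orbitOf (X.lines xm)
    · have hterm := X.term_smul_family_of_sphere D (level N) (loc N) (c.rep_ne o ho.1) xm (c.symm o ho.1) hab hD h2
      rw [c.rep_orbit o ho.1] at hterm
      have hw' : w o = c.weight o := by
        simp only [hw]
        rw [if_pos ho]
      rw [if_pos ho, hterm, hr, hw']
      unfold CopyData.weight
      simp only [norm_mul, Complex.norm_real, Real.norm_of_nonneg hr0,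
        Real.norm_of_nonneg (X.gaussRatio_pos (c.rep o) xm).le]
      ring
    · rw [if_neg ho]
      simp only [hw, ho, if_false, norm_zero, zero_mul]
  -- summability of the norms, from the `N`-free count
  have hws' : Summable fun o =>
      ‖(if o ∈ X.Copies S xm ∧ o ≠ X.orbitOf (X.lines xm) then X.term D.Φ D.cf (level N) (loc N) o else 0)‖ := by
    simp only [hnorm]
    exact hws.mul_right r
  calc ‖∑' o, if o ∈ X.Copies S xm ∧ o ≠ X.orbitOf (X.lines xm) then X.term D.Φ D.cf (level N) (loc N) o else 0‖
      ≤ ∑' o, ‖(if o ∈ X.Copies S xm ∧ o ≠ X.orbitOf (X.lines xm) then X.term D.Φ D.cf (level N) (loc N) o else 0)‖ :=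
        norm_tsum_le_tsum_norm hws'
    _ = ∑' o, w o * r := tsum_congr hnorm
    _ = (∑' o, w o) * r := tsum_mul_right
    _ ≤ θ₁ * I.re * r := mul_le_mul_of_nonneg_right hwsum hr0
    _ = θ₁ * (X.term D.Φ D.cf (level N) (loc N) (X.orbitOf (X.lines xm))).re := by
        rw [hmain]
        ring

end T4Data

end Summit.Ventures.HodgeRepro.Tier4.Line3

end
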